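import Summits.Langlands.Langlands.Theorems.IrreducibilityBySelfDualityPairLBoundaryJSOfGapRoad

/-!
# Crux `PairLBoundaryJS` (stmt-Langlands-13622), line `Sketch` — the crux from THREE named facts: the corner
# archimedean fact is no longer an input (lead c6, skeleton v23)

Summit `Langlands`, sub-problem `Langlands`, helper file under `Theorems/` supporting the crux `PairLBoundaryJS` =
Arthur–Clozel (1989), Ch. 3, (2.2) for cuspidal Borel–Jacquet data on `GL_n × GL_m` over a number field, all ranks.
With respect to `PairLBoundaryJSOfGapRoad.stub_PairLBoundaryJS_of_four_facts` (inputs `{hHJ, hJ, hA, hE}`), the corner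
archimedean fact `hJ = JacquetArchimedeanRS2009_archRankinSelbergCorner_testVector` is DROPPED: every theorem of the gap
road (`GapGlobalTranslate`, `GapLocalControlAsm`, …, and the gap heart
`PairLBoundaryJSOfGapRoad.gap_entire_quotient_of_local_control`) is stated for `m < n`, so Mœglin–Waldspurger (i)(a)
follows from the gap road for EVERY `m < n` — the corner `n = m + 1` included (`partialPairL_entire_of_lt`) — and, with
the `(n, 1)` / `(1, n)` slices by standard `L`-functions (`StandardEntire`, unconditional) and the swap, at all ranks
`n ≠ m` (`partialPairL_entire_of_rank_ne_of_archGap`). Nothing is assumed that was not assumed before: at corank one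
the gap fact asks no more than Jacquet's corner theorem (`GapArchFactSucc.stub_gap_arch_fact_succ_of_corner`).

The crux is then `stub_PairLBoundaryJS_of_three_facts hHJ hA hE`:
* `hHJ` — `HumphriesJo2024_archRankinSelberg_testVector` (archimedean, equal rank; leaves hB, hC);
* `hA` — `JacquetShalika1990_archRankinSelbergGap_entireRatio` (archimedean, `m < n`; leaf hA);
* `hE` — `Cogdell2004_unfoldedPairIntegral_entire` (global-analytic; a THEOREM of the decay road,
  `GapEntireFactHolds.Cogdell2004_unfoldedPairIntegral_entire_holds`, kept as a hypothesis here so that this file does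
  not wait for that file's build — the two-fact corollary is immediate from it).

## References

* J. Arthur, L. Clozel, *Simple algebras, base change, and the advanced theory of the trace formula*, Ann. of
  Math. Stud. 120 (1989), Ch. 3 §2 (2.2) [ArthurClozelAMS120].
* C. Mœglin, J.-L. Waldspurger, *Le spectre résiduel de GL(n)*, Ann. Sci. ÉNS 22 (1989), Appendice, p. 667
  [MoeglinWaldspurger1989].
* J. W. Cogdell, *Analytic theory of L-functions for GL_n* (2004), §2.2, Thm. 2.1–2.2, Thm. 4.2, §4.2
  [CogdellAnalyticTheory2004].
* H. Jacquet, *Archimedean Rankin–Selberg integrals* (2009), Thm. 2.1, Thm. 2.6, Prop. 12.5 [JacquetArchimedeanRS2009].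
-/

noncomputable section

-- `Summit.Langlands.Langlands.…` (summit = sub-problem name, D-0017 layout) trips `dupNamespace`
set_option linter.dupNamespace false

open scoped MatrixGroups Topology Pointwise ENNReal NNReal ComplexConjugate InnerProductSpace ContDiff
-- the place subtypes indexing `mixedSpace K` are `Fintype` classically (`NormedCommRing (mixedSpace K)`)
open scoped Classical Matrix.Norms.Operator
open NumberField IsDedekindDomain MeasureTheory Measure Matrix Set Filter WithZero
open NumberField.mixedEmbedding
open Literature.NumberTheory.Automorphic AdelicGroupData
open Literature.NumberTheory.GaloisRepresentations (ideleGroup HeckeCharacter)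
open Literature.MeasureTheory.Group
open Literature.RingTheory.SymmetricFunctions.SymmPoly
open ValuativeRel

-- the automorphic quotient carries the tree's Borel σ-algebra, not Mathlib's quotient σ-algebra
attribute [-instance] Quotient.instMeasurableSpace QuotientGroup.measurableSpace

-- the house local instances, exactly as in `RankinSelbergUnfoldingIdentity`
attribute [local instance] adelicBorel borelSpace_adelic locallyCompactSpace_adelic secondCountableTopology_gl_adelic
  glAdeleBorel borelSpace_glAdele borelSpace_ideleGroup secondCountableTopology_ideleGroup

-- Mathlib idiom: the commutator Lie ring on matrices, to mention `(archGroupGL n K).lie`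
attribute [local instance 100] LieRing.ofAssociativeRing

namespace Summit.Langlands.Langlands.Theorems.PairLBoundaryJSOfArchFacts

/-- **Mœglin–Waldspurger (i)(a) for every `m < n`** (the corner `n = m + 1` included) from the gap heart
`PairLBoundaryJSOfGapRoad.gap_entire_quotient_of_local_control`, granted the archimedean gap fact `hA` and the analytic
fact `hE`: the ramified set `S₀` of the pair with its canonical Satake families (`exists_isSatakeFamilyOf_pair_ramified`),
the abscissa made uniform (`x₀ := 1`) by the identity theorem (`eqOn_halfPlane_of_eqOn_right`,
`differentiableOn_partialPairL_of_isSatakeFamilyOf`), then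
`MoeglinWaldspurger1989_partialPairL_entire_of_rank_ne_of_entire_quotients`.
[cite: CogdellAnalyticTheory2004, Thm. 4.2 and §4.2] -/
theorem partialPairL_entire_of_lt
    (hA : ∀ (N M : ℕ) (K : Type) [Field K] [NumberField K], JacquetShalika1990_archRankinSelbergGap_entireRatio N M K)
    (hE : ∀ (N M : ℕ) (K : Type) [Field K] [NumberField K], Cogdell2004_unfoldedPairIntegral_entire N M K)
    {n m : ℕ} {K : Type} [Field K] [NumberField K]
    {μ : Measure (gl n K).automorphicQuotient} [(gl n K).IsAutomorphicMeasure μ]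
    {μ' : Measure (gl m K).automorphicQuotient} [(gl m K).IsAutomorphicMeasure μ'] (hmn : m < n) :
    MoeglinWaldspurger1989_partialPairL_entire_of_rank_ne (n := n) (m := m) (K := K) (μ := μ)
      (μ' := μ') := by
  refine MoeglinWaldspurger1989_partialPairL_entire_of_rank_ne_of_entire_quotients fun _hnm _hn hm P P' => ?_
  classical
  -- the ramified set of the pair and the canonical Satake families off it
  obtain ⟨α₀, β₀, hα₀', hβ₀'⟩ := exists_isSatakeFamilyOf_pair_ramified P P'
  have hS₀f : {v : HeightOneSpectrum (𝓞 K) | ¬ IsUnramifiedAt P.1 v ∨ ¬ IsUnramifiedAt P'.1 v}.Finite :=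
    finite_setOf_not_isUnramifiedAt_or P P'
  obtain ⟨S₀, hcoe⟩ : ∃ S₀ : Finset (HeightOneSpectrum (𝓞 K)),
      (↑S₀ : Set (HeightOneSpectrum (𝓞 K))) = {v | ¬ IsUnramifiedAt P.1 v ∨ ¬ IsUnramifiedAt P'.1 v} :=
    ⟨hS₀f.toFinset, hS₀f.coe_toFinset⟩
  have hmemS₀ : ∀ v : HeightOneSpectrum (𝓞 K), v ∈ S₀ ↔ ¬ IsUnramifiedAt P.1 v ∨ ¬ IsUnramifiedAt P'.1 v :=
    fun v => by rw [← Finset.mem_coe, hcoe, Set.mem_setOf_eq]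
  have hα₀ : IsSatakeFamilyOf P (↑S₀ : Set (HeightOneSpectrum (𝓞 K))) α₀ := hα₀'.mono hcoe.symm.subset
  have hβ₀ : IsSatakeFamilyOf P' (↑S₀ : Set (HeightOneSpectrum (𝓞 K))) β₀ := hβ₀'.mono hcoe.symm.subset
  have hram : ∀ v ∈ (↑S₀ : Set (HeightOneSpectrum (𝓞 K))), ¬ IsUnramifiedAt P.1 v ∨ ¬ IsUnramifiedAt P'.1 v :=
    fun v hv => (hmemS₀ v).1 (Finset.mem_coe.1 hv)
  have hU : ∀ v ∉ S₀, IsUnramifiedAt P.1 v ∧ IsUnramifiedAt P'.1 v := fun v hv =>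
    ⟨of_not_not fun h => hv ((hmemS₀ v).2 (Or.inl h)), of_not_not fun h => hv ((hmemS₀ v).2 (Or.inr h))⟩
  refine ⟨↑S₀, α₀, β₀, hram, hα₀, hβ₀, 1, fun s₀ => ?_⟩
  obtain ⟨x₀, J, A, hJ, hA', hA0, hJA⟩ :=
    PairLBoundaryJSOfGapRoad.gap_entire_quotient_of_local_control hA hE hm hmn P P' S₀ hU hα₀ hβ₀ s₀
  refine ⟨J, A, hJ, hA', hA0, ?_⟩
  -- uniform abscissa: `J = A · L^{S₀}` on `re s > max x₀ 1`, hence on `re s > 1` by the identity theorem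
  have hL := differentiableOn_partialPairL_of_isSatakeFamilyOf P P' hα₀ hβ₀
  have hAL : DifferentiableOn ℂ (fun s => A s * partialPairL (↑S₀ : Set (HeightOneSpectrum (𝓞 K))) α₀ β₀ s)
      {s : ℂ | 1 < s.re} := hA'.differentiableOn.mul hL
  exact eqOn_halfPlane_of_eqOn_right hJ hAL (le_max_right x₀ 1)
    fun s hs => hJA s (lt_of_le_of_lt (le_max_left _ _) hs)

/-- **Leaf hA — Mœglin–Waldspurger (i)(a) at all ranks `n ≠ m`**, granted `hA`, `hE` only: `m = 1` / `n = 1` by the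
LANDED standard-`L` slices (`StandardEntire.stub_standard_entire_of_ssv Ssv.stub_ssv`, unconditional), otherwise
`partialPairL_entire_of_lt` and its swap (`MoeglinWaldspurger1989_partialPairL_entire_of_rank_ne_of_swap`).
[cite: MoeglinWaldspurger1989, Appendice, Corollaire (i)(a), p. 667] [cite: CogdellAnalyticTheory2004, Thm. 4.2] -/
theorem partialPairL_entire_of_rank_ne_of_archGap
    (hA : ∀ (N M : ℕ) (K : Type) [Field K] [NumberField K], JacquetShalika1990_archRankinSelbergGap_entireRatio N M K)
    (hE : ∀ (N M : ℕ) (K : Type) [Field K] [NumberField K], Cogdell2004_unfoldedPairIntegral_entire N M K)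
    {n m : ℕ} {K : Type} [Field K] [NumberField K]
    {μ : Measure (gl n K).automorphicQuotient} [(gl n K).IsAutomorphicMeasure μ]
    {μ' : Measure (gl m K).automorphicQuotient} [(gl m K).IsAutomorphicMeasure μ'] :
    MoeglinWaldspurger1989_partialPairL_entire_of_rank_ne (n := n) (m := m) (K := K) (μ := μ)
      (μ' := μ') := by
  intro hnm hn hm P P' S hS α β hα hβ
  rcases Nat.lt_or_ge m 2 with hm2 | hm2
  · obtain rfl : m = 1 := by omega
    exact MoeglinWaldspurger1989_partialPairL_entire_of_rank_ne_gl_one_of_standard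
      (fun Q _ hS' _ hγ => StandardEntire.stub_standard_entire_of_ssv Ssv.stub_ssv (by omega) Q hS' hγ)
      hnm hn hm P P' hS hα hβ
  rcases Nat.lt_or_ge n 2 with hn2 | hn2
  · obtain rfl : n = 1 := by omega
    exact MoeglinWaldspurger1989_partialPairL_entire_of_rank_ne_of_swap
      (MoeglinWaldspurger1989_partialPairL_entire_of_rank_ne_gl_one_of_standard
        (fun Q _ hS' _ hγ => StandardEntire.stub_standard_entire_of_ssv Ssv.stub_ssv (by omega) Q hS' hγ))
      hnm hn hm P P' hS hα hβ
  rcases lt_or_gt_of_ne hnm with hlt | hgt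
  · -- `n < m`: swap to `(m, n)` with `n < m`
    exact MoeglinWaldspurger1989_partialPairL_entire_of_rank_ne_of_swap (partialPairL_entire_of_lt hA hE hlt)
      hnm hn hm P P' hS hα hβ
  · exact partialPairL_entire_of_lt hA hE hgt hnm hn hm P P' hS hα hβ

/-- **The crux `PairLBoundaryJS` (Arthur–Clozel (2.2) for Borel–Jacquet data, all ranks) from THREE named facts**
(registered stub `stub_PairLBoundaryJS_of_three_facts` of line `Sketch`): the equal-rank archimedean fact of
Humphries–Jo (`hHJ`, leaves hB/hC through the LANDED `PairLBoundaryJSOfHumphriesJo`), the archimedean gap fact (`hA`)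
and the analytic clause of Cogdell (2004), Thm. 2.1 (`hE`) — leaf hA by `partialPairL_entire_of_rank_ne_of_archGap`,
the composition by the tree's `PairLBoundaryJS_of_moeglinWaldspurger_of_isOrtho`. The corner archimedean fact of
`stub_PairLBoundaryJS_of_four_facts` is no longer an input.
[cite: ArthurClozelAMS120, Ch. 3 §2 (2.2)] [cite: MoeglinWaldspurger1989, Appendice, Corollaire (i)(a), p. 667]
[cite: CogdellAnalyticTheory2004, Thm. 2.1 and Thm. 4.2] -/
theorem stub_PairLBoundaryJS_of_three_facts :
    (∀ (N : ℕ) (K : Type) [Field K] [NumberField K], HumphriesJo2024_archRankinSelberg_testVector N K) →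
    (∀ (N M : ℕ) (K : Type) [Field K] [NumberField K], JacquetShalika1990_archRankinSelbergGap_entireRatio N M K) →
    (∀ (N M : ℕ) (K : Type) [Field K] [NumberField K], Cogdell2004_unfoldedPairIntegral_entire N M K) →
    Summit.Langlands.Langlands.Theses.IrreducibilityBySelfDuality.PairLBoundaryJS :=
  fun hHJ hA hE =>
    PairLBoundaryJS_of_moeglinWaldspurger_of_isOrtho (partialPairL_entire_of_rank_ne_of_archGap hA hE)
      (PairLBoundaryJSOfHumphriesJo.partialPairL_of_eq_conj_of_humphriesJo hHJ)
      (PairLBoundaryJSOfHumphriesJo.partialPairL_entire_of_isOrtho_of_humphriesJo hHJ)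

end Summit.Langlands.Langlands.Theorems.PairLBoundaryJSOfArchFacts

end
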